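import Literature.NumberTheory.Automorphic.SiegelConeDyadic
import HarnessLib

/-!
# Dyadic decomposition of the Siegel cone `A_{T₀}(t)` of `GL_n(𝔸_K)`, with the pieces INSIDE the cone

Topic `NumberTheory/Automorphic`; namespace `Literature.NumberTheory.Automorphic`. THEOREMS ONLY (no
definition, no instance, no named fact, no `sorry`).

The tree's `siegelCone_subset_iUnion_dyadic` (`SiegelConeDyadic`) covers the Siegel cone
`A_{T₀}(t) = {diag(z(a)) : ∏ aᵢ = 1, aᵢ ≥ t aᵢ₊₁}` by the dyadic pieces `diag(z(b_k)) · Q₀`, `k ∈ ℕ^{n-1}`,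
`b_k = ∏_l β_l^{k_l}` for the "simple-root generators" `β_l = 2^{-l/n}(2, …, 2, 1, …, 1)` and a compact set
`Q₀` of positive real diagonal matrices, with each `diag(z(β_l))⁻¹` strictly contracting Haar measure on
`N_n(𝔸_K)` — enough to bound the volume of a Siegel set from ABOVE by a convergent multiple geometric series
(Godement, Sém. Bourbaki 257, §8; Getz–Hahn (2024), Exercise 3.10). An estimate that integrates a
function which is only controlled ON the cone (e.g. a lattice-point count bounded by a power of
`∏_{i<j} aᵢ/aⱼ` for cone parameters `a`) needs the converse inclusion as well: **every piece lies in the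
cone**. This file re-runs the construction with the generators and the parameter box exposed and proves
exactly that:

* `posRealIdele_injective`, `posRealDiagonal_injective` — `z : ℝ_{>0} → 𝔸_Kˣ` and
  `a ↦ diag(z(a₁), …, z(aₙ))` are injective (`|z(r)|_𝔸 = r^{[K:ℚ]}`, `ideleNorm_posRealIdele_holds`);
* `siegelCone_subset_iUnion_dyadic_param` — generators `β` (products `∏ᵢ (β_l)ᵢ = 1`, antitone entries
  `(β_l)ᵢ₊₁ ≤ (β_l)ᵢ`, strict contraction `χ(z(β_l⁻¹)) < 1`) and a compact PARAMETER box
  `P₀ ⊆ (ℝ_{>0})ⁿ` whose elements are cone parameters (`∏ qᵢ = 1`, `t qᵢ₊₁ ≤ qᵢ`), such that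
  `A_{T₀}(t) ⊆ ⋃_k diag(z(b_k)) · diag(z(P₀))` and **`b_k · q` is a cone parameter for every `k` and every
  `q ∈ P₀`** (`∏ (b_k q)ᵢ = 1`, `t (b_k q)ᵢ₊₁ ≤ (b_k q)ᵢ`);
* `siegelCone_subset_iUnion_dyadic_mem_cone` — the same with `Q₀ = diag(z(P₀)) ⊆ GL_n(𝔸_K)` compact,
  `Q₀ ⊆ range diag∘z`, and the clause stated for `diag(z(q)) ∈ Q₀` (via injectivity) — the shape asked for by
  the orbit-count estimate of the S3 pool (cell `pub/hodgecm-mathlib`, ENGINE T1 line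
  `F0_T1InnerFormTraceIdentity`, brick T5a).

HC_CM is proved only modulo the printed citations until rung 0 closes; this file is unconditional `GL_n`
bookkeeping.

## References

* R. Godement, *Domaines fondamentaux des groupes arithmétiques*, Sém. Bourbaki 257 (1962/63), §8 (the
  volume of a Siegel set as an integral over the cone of the modulus) [Godement1964].
* J. R. Getz, H. Hahn, *An Introduction to Automorphic Representations* (2024), Thm. 2.6.2, Exercise 3.10
  [GetzHahn2024].
* A. Weil, *Basic Number Theory* (1967), Ch. IV §4 (the idele group and its module) [WeilBNT1967].
-/

noncomputable section

open MeasureTheory NumberField IsDedekindDomain Matrix Set Finset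
open scoped MatrixGroups ENNReal NNReal Pointwise

namespace Literature.NumberTheory.Automorphic

/-! ### Injectivity of the positive real diagonal embedding -/

section Injective

variable (n : ℕ) (K : Type) [Field K] [NumberField K]

/-- **`z : ℝ_{>0} → 𝔸_Kˣ` is injective**: `|z(r)|_𝔸 = r^{[K:ℚ]}` (`ideleNorm_posRealIdele_holds`) and
`r ↦ r^{[K:ℚ]}` is injective on `ℝ_{>0}` (`[K:ℚ] ≥ 1`; Weil, Ch. IV §4: the module of the real ray in the
idele group). [cite: WeilBNT1967, Ch. IV §4] -/
theorem posRealIdele_injective : Function.Injective (posRealIdele K) := by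
  intro r s hrs
  have hd : Module.finrank ℚ K ≠ 0 := Module.finrank_pos.ne'
  have h : ((r : ℝ≥0)) ^ Module.finrank ℚ K = (s : ℝ≥0) ^ Module.finrank ℚ K := by
    rw [← ideleNorm_posRealIdele_holds K r, ← ideleNorm_posRealIdele_holds K s, hrs]
  exact Units.ext ((pow_left_inj₀ zero_le zero_le hd).1 h)

/-- **`a ↦ diag(z(a₁), …, z(aₙ))` is injective** (`posRealDiagonal`; entrywise `posRealIdele_injective`).
[cite: WeilBNT1967, Ch. IV §4] -/
theorem posRealDiagonal_injective : Function.Injective (posRealDiagonal n K) := by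
  intro a b hab
  funext i
  have h := congrArg (fun g : GL (Fin n) (AdeleRing (𝓞 K) K) =>
    (g : Matrix (Fin n) (Fin n) (AdeleRing (𝓞 K) K)) i i) hab
  simp only [coe_posRealDiagonal, Matrix.diagonal_apply_eq] at h
  exact posRealIdele_injective K (Units.ext h)

end Injective

/-! ### Real products and ratios of exponential units -/

section ExpUnit

/-- `∏ᵢ e^{fᵢ} = e^{∑ fᵢ}` read in `ℝ` through the coercions `ℝ≥0ˣ → ℝ≥0 → ℝ`. [folklore] -/
private theorem prod_coe_expUnitNNReal {ι : Type*} (s : Finset ι) (f : ι → ℝ) :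
    (∏ i ∈ s, (((expUnitNNReal (f i) : ℝ≥0ˣ) : ℝ≥0) : ℝ)) = Real.exp (∑ i ∈ s, f i) := by
  rw [Real.exp_sum]
  exact Finset.prod_congr rfl fun i _ => coe_expUnitNNReal (f i)

/-- `t · e^{b} ≤ e^{a}` as soon as `log t + b ≤ a` (`t > 0`). [folklore] -/
private theorem mul_coe_expUnitNNReal_le {t a b : ℝ} (ht : 0 < t) (h : Real.log t + b ≤ a) :
    t * (((expUnitNNReal b : ℝ≥0ˣ) : ℝ≥0) : ℝ) ≤ (((expUnitNNReal a : ℝ≥0ˣ) : ℝ≥0) : ℝ) := by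
  rw [coe_expUnitNNReal, coe_expUnitNNReal]
  calc t * Real.exp b = Real.exp (Real.log t + b) := by rw [Real.exp_add, Real.exp_log ht]
    _ ≤ Real.exp a := Real.exp_le_exp.2 h

end ExpUnit

/-! ### The dyadic decomposition with the pieces inside the cone -/

section Cone

variable (n : ℕ) (K : Type) [Field K] [NumberField K]

/-- **Dyadic decomposition of the Siegel cone, parameter form, with the pieces inside the cone.** For
`t > 0` there are positive real "simple-root generators" `β₁, …, β_{n-1} ∈ (ℝ_{>0})ⁿ` —
`β_l = 2^{-l/n}(2, …, 2, 1, …, 1)` (`l` entries `2`) — and a compact PARAMETER box `P₀ ⊆ (ℝ_{>0})ⁿ` with: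
* `χ(z(β_l⁻¹)) < 1` for every `l` (strict contraction of Haar measure on `N_n(𝔸_K)`,
  `unipotentConjChar_posRealIdele_lt_one`);
* `∏ᵢ (β_l)ᵢ = 1` and `(β_l)ⱼ ≤ (β_l)ᵢ` for consecutive `i, j = i + 1` (so every `b_k = ∏_l β_l^{k_l}`,
  `k ∈ ℕ^{n-1}`, has product `1` and ratios `(b_k)ᵢ/(b_k)ᵢ₊₁ = 2^{kᵢ} ≥ 1`);
* every `q ∈ P₀` is a cone parameter: `∏ qᵢ = 1`, `t qⱼ ≤ qᵢ` (`j = i + 1`);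
* `A_{T₀}(t) ⊆ ⋃_{k} diag(z(b_k)) · diag(z(P₀))`;
* **every piece lies in the cone**: for every `k` and `q ∈ P₀`, `∏ (b_k q)ᵢ = 1` and `t (b_k q)ⱼ ≤ (b_k q)ᵢ`.
Construction as in `siegelCone_subset_iUnion_dyadic` (`P₀` = exponential of the logarithmic box with
consecutive differences in `[log t, log t + log 2]` and sum `0`, `isCompact_logBox`); the new clauses are
read off the logarithmic coordinates: `log (b_k q)ᵢ − log (b_k q)ᵢ₊₁ = kᵢ log 2 + (xᵢ − xᵢ₊₁) ≥ log t`.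
This is the discretisation of "the volume of a Siegel set is the integral over the cone of the modulus of
the torus on `Lie(U_𝔸)`" (Godement, §8, remark after Thm. 7). [cite: Godement1964, §8 (remark after Thm. 7)] -/
theorem siegelCone_subset_iUnion_dyadic_param {t : ℝ} (ht : 0 < t) :
    ∃ β : Fin (n - 1) → (Fin n → ℝ≥0ˣ),
      (∀ l, unipotentConjChar (fun i => posRealIdele K ((β l)⁻¹ i)) < 1) ∧
      (∀ l, (∏ i, (((β l i : ℝ≥0ˣ) : ℝ≥0) : ℝ)) = 1) ∧
      (∀ l (i j : Fin n), (j : ℕ) = i + 1 → (((β l j : ℝ≥0ˣ) : ℝ≥0) : ℝ) ≤ ((β l i : ℝ≥0ˣ) : ℝ≥0)) ∧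
      ∃ P₀ : Set (Fin n → ℝ≥0ˣ), IsCompact P₀ ∧
        (∀ q ∈ P₀, (∏ i, (((q i : ℝ≥0ˣ) : ℝ≥0) : ℝ)) = 1 ∧
          ∀ i j : Fin n, (j : ℕ) = i + 1 → t * (((q j : ℝ≥0ˣ) : ℝ≥0) : ℝ) ≤ ((q i : ℝ≥0ˣ) : ℝ≥0)) ∧
        siegelCone n K t ⊆
          ⋃ k : Fin (n - 1) → ℕ, {posRealDiagonal n K (∏ l, β l ^ k l)} * (posRealDiagonal n K '' P₀) ∧
        (∀ (k : Fin (n - 1) → ℕ) (q : Fin n → ℝ≥0ˣ), q ∈ P₀ →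
          (∏ i, ((((∏ l, β l ^ k l) * q) i : ℝ≥0ˣ) : ℝ≥0) : ℝ) = 1 ∧
          ∀ i j : Fin n, (j : ℕ) = i + 1 →
            t * (((((∏ l, β l ^ k l) * q) j : ℝ≥0ˣ) : ℝ≥0) : ℝ) ≤
              ((((∏ l, β l ^ k l) * q) i : ℝ≥0ˣ) : ℝ≥0)) := by
  classical
  set L2 : ℝ := Real.log 2 with hL2
  have hL2pos : 0 < L2 := Real.log_pos one_lt_two
  have hl : ∀ l : Fin (n - 1), (l : ℕ) + 1 < n := fun l => by have := l.2; omega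
  -- exponents of the generators
  set ex : Fin (n - 1) → Fin n → ℝ := fun l i =>
    (if (i : ℕ) < l + 1 then L2 else 0) - (((l : ℕ) + 1 : ℝ) / n) * L2 with hex
  set β : Fin (n - 1) → (Fin n → ℝ≥0ˣ) := fun l i => expUnitNNReal (ex l i) with hβ
  have hβinv : ∀ l i, (β l)⁻¹ i = expUnitNNReal (-ex l i) := fun l i => by
    rw [Pi.inv_apply, hβ, inv_expUnitNNReal]
  -- (F1) the exponents of each generator sum to zero
  have hexsum : ∀ l : Fin (n - 1), ∑ i : Fin n, ex l i = 0 := by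
    intro l
    have hn : n ≠ 0 := by have := l.2; omega
    rw [hex]
    simp only
    rw [Finset.sum_sub_distrib, Finset.sum_const, Finset.card_univ, Fintype.card_fin,
      nsmul_eq_mul, ← Finset.sum_filter, Finset.sum_const, nsmul_eq_mul,
      Fin.card_filter_val_lt, min_eq_right (hl l).le]
    field_simp
    push_cast
    ring
  -- (F2) consecutive differences of the exponents: `L2` at the slot `l = i`, else `0`
  have hdiff : ∀ (i j : Fin n) (hij : (j : ℕ) = i + 1) (l : Fin (n - 1)),
      ex l i - ex l j = if (l : ℕ) = i then L2 else 0 := by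
    intro i j hij l
    rw [hex]
    simp only
    rw [sub_sub_sub_cancel_right]
    by_cases hli : (l : ℕ) = i
    · rw [if_pos hli]
      have h1 : (i : ℕ) < l + 1 := by omega
      have h2 : ¬ ((j : ℕ) < l + 1) := by omega
      rw [if_pos h1, if_neg h2, sub_zero]
    · rw [if_neg hli]
      by_cases h1 : (i : ℕ) < l + 1
      · have h2 : (j : ℕ) < l + 1 := by omega
        rw [if_pos h1, if_pos h2, sub_self]
      · have h2 : ¬ ((j : ℕ) < l + 1) := by omega
        rw [if_neg h1, if_neg h2, sub_self]
  have hdiff_nonneg : ∀ (i j : Fin n), (j : ℕ) = i + 1 → ∀ l : Fin (n - 1), 0 ≤ ex l i - ex l j := by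
    intro i j hij l
    rw [hdiff i j hij l]
    split_ifs
    · exact hL2pos.le
    · exact le_rfl
  -- (F3) the entries of `b_k = ∏_l β_l^{k_l}` in logarithmic coordinates
  have hbk : ∀ (k : Fin (n - 1) → ℕ) (i : Fin n),
      (∏ l, β l ^ k l) i = expUnitNNReal (∑ l, (k l : ℝ) * ex l i) := by
    intro k i
    rw [Finset.prod_apply]
    simp_rw [Pi.pow_apply, hβ, expUnitNNReal_pow]
    exact prod_expUnitNNReal _ _
  -- the parameter box
  set X₀ : Set (Fin n → ℝ) := {x | (∀ i j : Fin n, (j : ℕ) = i + 1 →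
      x i - x j ∈ Set.Icc (Real.log t) (Real.log t + L2)) ∧ ∑ i, x i = 0} with hX₀
  set E : (Fin n → ℝ) → (Fin n → ℝ≥0ˣ) := fun x i => expUnitNNReal (x i) with hE
  have hEc : Continuous E := continuous_pi fun i => continuous_expUnitNNReal.comp (continuous_apply i)
  set P₀ : Set (Fin n → ℝ≥0ˣ) := E '' X₀ with hP₀
  refine ⟨β, fun l => ?_, fun l => ?_, fun l i j hij => ?_, P₀, (isCompact_logBox n _ _).image hEc,
    ?_, ?_, ?_⟩
  · -- strict contraction of the inverse generators (as in `siegelCone_subset_iUnion_dyadic`)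
    have hmono : ∀ i j : Fin n, i ≤ j → (((β l)⁻¹ i : ℝ≥0ˣ) : ℝ≥0) ≤ (β l)⁻¹ j := by
      intro i j hij
      rw [hβinv, hβinv, expUnitNNReal_le_iff, neg_le_neg_iff, hex]
      simp only
      refine sub_le_sub_right ?_ _
      by_cases hj : (j : ℕ) < l + 1
      · have hi : (i : ℕ) < l + 1 := lt_of_le_of_lt (by exact_mod_cast hij) hj
        rw [if_pos hi, if_pos hj]
      · rw [if_neg hj]
        split_ifs
        · exact hL2pos.le
        · exact le_rfl
    have hlt : (⟨l, by have := l.2; omega⟩ : Fin n) < ⟨(l : ℕ) + 1, hl l⟩ :=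
      Fin.mk_lt_mk.2 (Nat.lt_succ_self _)
    have hjump : (((β l)⁻¹ ⟨l, by have := l.2; omega⟩ : ℝ≥0ˣ) : ℝ≥0) <
        (β l)⁻¹ ⟨(l : ℕ) + 1, hl l⟩ := by
      rw [hβinv, hβinv, expUnitNNReal_lt_iff, neg_lt_neg_iff, hex]
      simp only [lt_irrefl, if_false, Nat.lt_succ_self, if_true]
      linarith
    exact unipotentConjChar_posRealIdele_lt_one hmono hlt hjump
  · -- `∏ᵢ (β_l)ᵢ = 1`
    change (∏ i, (((expUnitNNReal (ex l i) : ℝ≥0ˣ) : ℝ≥0) : ℝ)) = 1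
    rw [prod_coe_expUnitNNReal, hexsum, Real.exp_zero]
  · -- `(β_l)ⱼ ≤ (β_l)ᵢ` for `j = i + 1`
    change (((expUnitNNReal (ex l j) : ℝ≥0ˣ) : ℝ≥0) : ℝ) ≤ (((expUnitNNReal (ex l i) : ℝ≥0ˣ) : ℝ≥0) : ℝ)
    rw [coe_expUnitNNReal, coe_expUnitNNReal, Real.exp_le_exp]
    linarith [hdiff_nonneg i j hij l]
  · -- every `q ∈ P₀` is a cone parameter
    rintro q ⟨x, hx, rfl⟩
    refine ⟨?_, fun i j hij => ?_⟩
    · change (∏ i, (((expUnitNNReal (x i) : ℝ≥0ˣ) : ℝ≥0) : ℝ)) = 1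
      rw [prod_coe_expUnitNNReal, hx.2, Real.exp_zero]
    · change t * (((expUnitNNReal (x j) : ℝ≥0ˣ) : ℝ≥0) : ℝ) ≤ (((expUnitNNReal (x i) : ℝ≥0ˣ) : ℝ≥0) : ℝ)
      exact mul_coe_expUnitNNReal_le ht (by linarith [(hx.1 i j hij).1])
  · -- the covering (as in `siegelCone_subset_iUnion_dyadic`)
    intro g hg
    obtain ⟨a, hprod, hroot, rfl⟩ := hg
    have hapos : ∀ i, 0 < ((a i : ℝ≥0) : ℝ) := fun i =>
      NNReal.coe_pos.2 (pos_iff_ne_zero.2 (a i).ne_zero)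
    -- logarithmic coordinates of `a`
    set y : Fin n → ℝ := fun i => Real.log ((a i : ℝ≥0) : ℝ) with hy
    have hy_sum : ∑ i, y i = 0 := by
      rw [hy]
      simp only
      rw [← Real.log_prod (s := Finset.univ) (f := fun i => ((a i : ℝ≥0) : ℝ)) (fun i _ => (hapos i).ne'),
        hprod, Real.log_one]
    have hy_root : ∀ i j : Fin n, (j : ℕ) = i + 1 → Real.log t ≤ y i - y j := by
      intro i j hij
      have h := Real.log_le_log (mul_pos ht (hapos j)) (hroot i j hij)
      rw [Real.log_mul ht.ne' (hapos j).ne'] at h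
      rw [hy]
      simp only
      linarith
    -- dyadic exponents
    set k : Fin (n - 1) → ℕ := fun l =>
      ⌊(y ⟨l, by have := l.2; omega⟩ - y ⟨(l : ℕ) + 1, hl l⟩ - Real.log t) / L2⌋₊ with hk
    set x : Fin n → ℝ := fun i => y i - ∑ l, (k l : ℝ) * ex l i with hx
    refine Set.mem_iUnion.2 ⟨k, Set.mem_mul.2 ⟨_, Set.mem_singleton _, posRealDiagonal n K (E x),
      ⟨E x, ⟨x, ⟨?_, ?_⟩, rfl⟩, rfl⟩, ?_⟩⟩
    · -- consecutive differences of `x`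
      intro i j hij
      have hi : (i : ℕ) < n - 1 := by have := j.2; omega
      set l₀ : Fin (n - 1) := ⟨i, hi⟩ with hl₀
      have hsum : ∑ l, (k l : ℝ) * (ex l i - ex l j) = k l₀ * L2 := by
        have e : ∀ l : Fin (n - 1), (k l : ℝ) * (ex l i - ex l j) = if l = l₀ then (k l : ℝ) * L2 else 0 := by
          intro l
          rw [hdiff i j hij l]
          by_cases hll : l = l₀
          · rw [if_pos hll, if_pos (by rw [hll, hl₀])]
          · have : (l : ℕ) ≠ i := fun h => hll (Fin.ext (by rw [hl₀]; exact h))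
            rw [if_neg this, if_neg hll, mul_zero]
        simp_rw [e]
        rw [Finset.sum_ite_eq' Finset.univ l₀, if_pos (Finset.mem_univ _)]
      have hxij : x i - x j = (y i - y j) - k l₀ * L2 := by
        rw [hx]
        simp only
        rw [sub_sub_sub_comm, ← Finset.sum_sub_distrib]
        simp_rw [← mul_sub]
        rw [hsum]
      -- the floor estimate
      set D : ℝ := y i - y j - Real.log t with hD
      have hD0 : 0 ≤ D := by have := hy_root i j hij; rw [hD]; linarith
      have hkl₀ : (k l₀ : ℝ) = ⌊D / L2⌋₊ := by
        rw [hk, hD]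
        simp only
        have e1 : (⟨((l₀ : Fin (n - 1)) : ℕ), by have := l₀.2; omega⟩ : Fin n) = i := Fin.ext rfl
        have e2 : (⟨((l₀ : Fin (n - 1)) : ℕ) + 1, hl l₀⟩ : Fin n) = j := Fin.ext (by rw [hl₀]; exact hij.symm)
        rw [e1, e2]
      have hfl : (⌊D / L2⌋₊ : ℝ) ≤ D / L2 := Nat.floor_le (div_nonneg hD0 hL2pos.le)
      have hfl' : D / L2 < ⌊D / L2⌋₊ + 1 := Nat.lt_floor_add_one _
      rw [hxij, hkl₀]
      have e3 : y i - y j = Real.log t + D := by rw [hD]; ring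
      rw [e3]
      constructor
      · have : (⌊D / L2⌋₊ : ℝ) * L2 ≤ D := by rwa [← le_div_iff₀ hL2pos]
        linarith
      · have : D < (⌊D / L2⌋₊ + 1) * L2 := by rwa [← div_lt_iff₀ hL2pos]
        linarith
    · -- `∑ xᵢ = 0`
      rw [hx]
      simp only
      rw [Finset.sum_sub_distrib, hy_sum, Finset.sum_comm]
      simp_rw [← Finset.mul_sum, hexsum, mul_zero, Finset.sum_const_zero, sub_zero]
    · -- `diag(∏ β_l^{k_l}) · diag(E x) = diag(a)`
      rw [← map_mul]
      congr 1
      funext i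
      rw [Pi.mul_apply, hbk, hE]
      simp only
      rw [← expUnitNNReal_add, hx]
      simp only
      rw [add_sub_cancel, hy]
      exact expUnitNNReal_log (a i)
  · -- every piece lies in the cone
    rintro k q ⟨x, hx, rfl⟩
    have hentry : ∀ i, ((∏ l, β l ^ k l) * E x) i = expUnitNNReal ((∑ l, (k l : ℝ) * ex l i) + x i) := by
      intro i
      rw [Pi.mul_apply, hbk, hE, expUnitNNReal_add]
    refine ⟨?_, fun i j hij => ?_⟩
    · simp_rw [hentry]
      rw [prod_coe_expUnitNNReal, Finset.sum_add_distrib, hx.2, add_zero, Finset.sum_comm]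
      simp_rw [← Finset.mul_sum, hexsum, mul_zero, Finset.sum_const_zero, Real.exp_zero]
    · rw [hentry, hentry]
      refine mul_coe_expUnitNNReal_le ht ?_
      have h1 : Real.log t ≤ x i - x j := (hx.1 i j hij).1
      have h2 : 0 ≤ ∑ l, (k l : ℝ) * ex l i - ∑ l, (k l : ℝ) * ex l j := by
        rw [← Finset.sum_sub_distrib]
        exact Finset.sum_nonneg fun l _ => by
          rw [← mul_sub]
          exact mul_nonneg (Nat.cast_nonneg _) (hdiff_nonneg i j hij l)
      linarith

/-- **Dyadic decomposition of the Siegel cone with the pieces inside the cone** (`GL_n(𝔸_K)` form): for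
`t > 0` there are generators `β₁, …, β_{n-1}` with `χ(z(β_l⁻¹)) < 1` and a compact set `Q₀ ⊆ GL_n(𝔸_K)` of
positive real diagonal matrices with `A_{T₀}(t) ⊆ ⋃_k diag(z(∏_l β_l^{k_l})) · Q₀`, such that for every
`k ∈ ℕ^{n-1}` and every `diag(z(q)) ∈ Q₀` the product `(∏_l β_l^{k_l}) · q` is a parameter of the cone
`A_{T₀}(t)` (`∏ = 1`, consecutive ratios `≥ t`) — the pieces of `siegelCone_subset_iUnion_dyadic` all lie
in `siegelCone n K t`. [cite: Godement1964, §8 (remark after Thm. 7)] -/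
theorem siegelCone_subset_iUnion_dyadic_mem_cone {t : ℝ} (ht : 0 < t) :
    ∃ β : Fin (n - 1) → (Fin n → ℝ≥0ˣ),
      (∀ l, unipotentConjChar (fun i => posRealIdele K ((β l)⁻¹ i)) < 1) ∧
      ∃ Q₀ : Set (GL (Fin n) (AdeleRing (𝓞 K) K)), IsCompact Q₀ ∧
        Q₀ ⊆ Set.range (posRealDiagonal n K) ∧
        siegelCone n K t ⊆
          ⋃ k : Fin (n - 1) → ℕ, {posRealDiagonal n K (∏ l, β l ^ k l)} * Q₀ ∧
        ∀ (k : Fin (n - 1) → ℕ) (q : Fin n → ℝ≥0ˣ), posRealDiagonal n K q ∈ Q₀ →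
          (∏ i, ((((∏ l, β l ^ k l) * q) i : ℝ≥0ˣ) : ℝ≥0) : ℝ) = 1 ∧
          ∀ i j : Fin n, (j : ℕ) = i + 1 →
            t * (((((∏ l, β l ^ k l) * q) j : ℝ≥0ˣ) : ℝ≥0) : ℝ) ≤
              ((((∏ l, β l ^ k l) * q) i : ℝ≥0ˣ) : ℝ≥0) := by
  obtain ⟨β, hχ, -, -, P₀, hP₀c, -, hcov, hcone⟩ := siegelCone_subset_iUnion_dyadic_param n K ht
  have hc : Continuous (posRealDiagonal n K) := by
    change Continuous fun a : Fin n → ℝ≥0ˣ => glDiagonal n (AdeleRing (𝓞 K) K) fun i => posRealIdele K (a i)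
    exact (continuous_glDiagonal (AdeleRing (𝓞 K) K)).comp
      (continuous_pi fun i => (continuous_posRealIdele K).comp (continuous_apply i))
  refine ⟨β, hχ, posRealDiagonal n K '' P₀, hP₀c.image hc, ?_, hcov, fun k q hq => ?_⟩
  · rintro _ ⟨q, _, rfl⟩
    exact ⟨q, rfl⟩
  · obtain ⟨q', hq', hqq'⟩ := hq
    obtain rfl : q = q' := (posRealDiagonal_injective n K hqq').symm
    exact hcone k q hq'

/-- **Every dyadic piece is a subset of the cone**: in the decomposition of
`siegelCone_subset_iUnion_dyadic_mem_cone`, `diag(z(∏_l β_l^{k_l})) · Q₀ ⊆ A_{T₀}(t)` for every `k`.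
[cite: Godement1964, §8 (remark after Thm. 7)] -/
theorem siegelCone_eq_iUnion_dyadic {t : ℝ} (ht : 0 < t) :
    ∃ β : Fin (n - 1) → (Fin n → ℝ≥0ˣ),
      (∀ l, unipotentConjChar (fun i => posRealIdele K ((β l)⁻¹ i)) < 1) ∧
      ∃ Q₀ : Set (GL (Fin n) (AdeleRing (𝓞 K) K)), IsCompact Q₀ ∧
        Q₀ ⊆ Set.range (posRealDiagonal n K) ∧
        siegelCone n K t = ⋃ k : Fin (n - 1) → ℕ, {posRealDiagonal n K (∏ l, β l ^ k l)} * Q₀ := by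
  obtain ⟨β, hχ, Q₀, hQ₀c, hQ₀r, hcov, hcone⟩ := siegelCone_subset_iUnion_dyadic_mem_cone n K ht
  refine ⟨β, hχ, Q₀, hQ₀c, hQ₀r, le_antisymm hcov ?_⟩
  intro g hg
  obtain ⟨k, hk⟩ := Set.mem_iUnion.1 hg
  obtain ⟨b, hb, g₀, hg₀, rfl⟩ := Set.mem_mul.1 hk
  rw [Set.mem_singleton_iff] at hb
  subst hb
  obtain ⟨q, rfl⟩ := hQ₀r hg₀
  obtain ⟨hprod, hroot⟩ := hcone k q hg₀
  exact ⟨(∏ l, β l ^ k l) * q, hprod, hroot, by rw [map_mul]⟩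

/-- **Dyadic decomposition of the Siegel cone — the shape consumed by the hermitian orbit count** (exact
statement requested by the S3 pool's T5): generators `β_l` with `χ(z(β_l⁻¹)) < 1`, `∏ᵢ (β_l)ᵢ = 1` and
ANTITONE entries (`(β_l)ⱼ ≤ (β_l)ᵢ` for all `i ≤ j`), and a compact `Q₀ ⊆ GL_n(𝔸_K)` every element of which
is `diag(z(q))` for a cone parameter `q` with consecutive ratios in `[t, 2t]` (`t qⱼ ≤ qᵢ ≤ 2t qⱼ`, `j = i + 1`,
and `∏ qᵢ = 1`), with `A_{T₀}(t) ⊆ ⋃_k diag(z(∏_l β_l^{k_l})) · Q₀`. Same construction as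
`siegelCone_subset_iUnion_dyadic_param` (the logarithmic box has consecutive differences in
`[log t, log t + log 2]`). [cite: Godement1964, §8 (remark after Thm. 7)] -/
theorem siegelCone_subset_iUnion_dyadic_explicit {t : ℝ} (ht : 0 < t) :
    ∃ β : Fin (n - 1) → (Fin n → ℝ≥0ˣ),
      (∀ l, unipotentConjChar (fun i => posRealIdele K ((β l)⁻¹ i)) < 1) ∧
      (∀ l, (∏ i, (((β l) i : ℝ≥0) : ℝ)) = 1) ∧
      (∀ l (i j : Fin n), i ≤ j → (((β l) j : ℝ≥0) : ℝ) ≤ (((β l) i : ℝ≥0) : ℝ)) ∧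
      ∃ Q₀ : Set (GL (Fin n) (AdeleRing (𝓞 K) K)), IsCompact Q₀ ∧
        (∀ g ∈ Q₀, ∃ q : Fin n → ℝ≥0ˣ, posRealDiagonal n K q = g ∧ (∏ i, ((q i : ℝ≥0) : ℝ)) = 1 ∧
          ∀ i j : Fin n, (j : ℕ) = (i : ℕ) + 1 →
            t * ((q j : ℝ≥0) : ℝ) ≤ ((q i : ℝ≥0) : ℝ) ∧ ((q i : ℝ≥0) : ℝ) ≤ 2 * t * ((q j : ℝ≥0) : ℝ)) ∧
        siegelCone n K t ⊆ ⋃ k : Fin (n - 1) → ℕ, {posRealDiagonal n K (∏ l, β l ^ k l)} * Q₀ := by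
  classical
  set L2 : ℝ := Real.log 2 with hL2
  have hL2pos : 0 < L2 := Real.log_pos one_lt_two
  have hl : ∀ l : Fin (n - 1), (l : ℕ) + 1 < n := fun l => by have := l.2; omega
  -- exponents of the generators
  set ex : Fin (n - 1) → Fin n → ℝ := fun l i =>
    (if (i : ℕ) < l + 1 then L2 else 0) - (((l : ℕ) + 1 : ℝ) / n) * L2 with hex
  set β : Fin (n - 1) → (Fin n → ℝ≥0ˣ) := fun l i => expUnitNNReal (ex l i) with hβ
  have hβinv : ∀ l i, (β l)⁻¹ i = expUnitNNReal (-ex l i) := fun l i => by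
    rw [Pi.inv_apply, hβ, inv_expUnitNNReal]
  -- the exponents are antitone in `i`
  have hex_anti : ∀ (l : Fin (n - 1)) (i j : Fin n), i ≤ j → ex l j ≤ ex l i := by
    intro l i j hij
    rw [hex]
    simp only
    refine sub_le_sub_right ?_ _
    by_cases hj : (j : ℕ) < l + 1
    · have hi : (i : ℕ) < l + 1 := lt_of_le_of_lt (by exact_mod_cast hij) hj
      rw [if_pos hi, if_pos hj]
    · rw [if_neg hj]
      split_ifs
      · exact hL2pos.le
      · exact le_rfl
  -- the exponents of each generator sum to zero
  have hexsum : ∀ l : Fin (n - 1), ∑ i : Fin n, ex l i = 0 := by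
    intro l
    have hn : n ≠ 0 := by have := l.2; omega
    rw [hex]
    simp only
    rw [Finset.sum_sub_distrib, Finset.sum_const, Finset.card_univ, Fintype.card_fin,
      nsmul_eq_mul, ← Finset.sum_filter, Finset.sum_const, nsmul_eq_mul,
      Fin.card_filter_val_lt, min_eq_right (hl l).le]
    field_simp
    push_cast
    ring
  -- consecutive differences of the exponents
  have hdiff : ∀ (i j : Fin n) (hij : (j : ℕ) = i + 1) (l : Fin (n - 1)),
      ex l i - ex l j = if (l : ℕ) = i then L2 else 0 := by
    intro i j hij l
    rw [hex]
    simp only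
    rw [sub_sub_sub_cancel_right]
    by_cases hli : (l : ℕ) = i
    · rw [if_pos hli]
      have h1 : (i : ℕ) < l + 1 := by omega
      have h2 : ¬ ((j : ℕ) < l + 1) := by omega
      rw [if_pos h1, if_neg h2, sub_zero]
    · rw [if_neg hli]
      by_cases h1 : (i : ℕ) < l + 1
      · have h2 : (j : ℕ) < l + 1 := by omega
        rw [if_pos h1, if_pos h2, sub_self]
      · have h2 : ¬ ((j : ℕ) < l + 1) := by omega
        rw [if_neg h1, if_neg h2, sub_self]
  -- entries of `b_k`
  have hbk : ∀ (k : Fin (n - 1) → ℕ) (i : Fin n),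
      (∏ l, β l ^ k l) i = expUnitNNReal (∑ l, (k l : ℝ) * ex l i) := by
    intro k i
    rw [Finset.prod_apply]
    simp_rw [Pi.pow_apply, hβ, expUnitNNReal_pow]
    exact prod_expUnitNNReal _ _
  -- the box and its image
  set X₀ : Set (Fin n → ℝ) := {x | (∀ i j : Fin n, (j : ℕ) = i + 1 →
      x i - x j ∈ Set.Icc (Real.log t) (Real.log t + L2)) ∧ ∑ i, x i = 0} with hX₀
  set Φ : (Fin n → ℝ) → GL (Fin n) (AdeleRing (𝓞 K) K) := fun x =>
    posRealDiagonal n K fun i => expUnitNNReal (x i) with hΦ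
  refine ⟨β, fun l => ?_, fun l => ?_, fun l i j hij => ?_, Φ '' X₀,
    (isCompact_logBox n _ _).image (continuous_posRealDiagonal_expUnitNNReal n K), ?_, ?_⟩
  · -- strict contraction of the inverse generators
    have hmono : ∀ i j : Fin n, i ≤ j → (((β l)⁻¹ i : ℝ≥0ˣ) : ℝ≥0) ≤ (β l)⁻¹ j := by
      intro i j hij
      rw [hβinv, hβinv, expUnitNNReal_le_iff, neg_le_neg_iff]
      exact hex_anti l i j hij
    have hlt : (⟨l, by have := l.2; omega⟩ : Fin n) < ⟨(l : ℕ) + 1, hl l⟩ :=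
      Fin.mk_lt_mk.2 (Nat.lt_succ_self _)
    have hjump : (((β l)⁻¹ ⟨l, by have := l.2; omega⟩ : ℝ≥0ˣ) : ℝ≥0) <
        (β l)⁻¹ ⟨(l : ℕ) + 1, hl l⟩ := by
      rw [hβinv, hβinv, expUnitNNReal_lt_iff, neg_lt_neg_iff, hex]
      simp only [lt_irrefl, if_false, Nat.lt_succ_self, if_true]
      linarith
    exact unipotentConjChar_posRealIdele_lt_one hmono hlt hjump
  · -- `∏ᵢ (β_l)ᵢ = 1`
    change (∏ i, (((expUnitNNReal (ex l i) : ℝ≥0ˣ) : ℝ≥0) : ℝ)) = 1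
    rw [prod_coe_expUnitNNReal, hexsum, Real.exp_zero]
  · -- antitone entries
    change (((expUnitNNReal (ex l j) : ℝ≥0ˣ) : ℝ≥0) : ℝ) ≤ (((expUnitNNReal (ex l i) : ℝ≥0ˣ) : ℝ≥0) : ℝ)
    rw [coe_expUnitNNReal, coe_expUnitNNReal, Real.exp_le_exp]
    exact hex_anti l i j hij
  · -- elements of `Q₀` are cone parameters with consecutive ratios in `[t, 2t]`
    rintro g ⟨x, hx, rfl⟩
    refine ⟨fun i => expUnitNNReal (x i), rfl, ?_, fun i j hij => ⟨?_, ?_⟩⟩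
    · change (∏ i, (((expUnitNNReal (x i) : ℝ≥0ˣ) : ℝ≥0) : ℝ)) = 1
      rw [prod_coe_expUnitNNReal, hx.2, Real.exp_zero]
    · exact mul_coe_expUnitNNReal_le ht (by linarith [(hx.1 i j hij).1])
    · change (((expUnitNNReal (x i) : ℝ≥0ˣ) : ℝ≥0) : ℝ) ≤ 2 * t * (((expUnitNNReal (x j) : ℝ≥0ˣ) : ℝ≥0) : ℝ)
      rw [coe_expUnitNNReal, coe_expUnitNNReal]
      have h2 : x i ≤ Real.log t + L2 + x j := by linarith [(hx.1 i j hij).2]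
      calc Real.exp (x i) ≤ Real.exp (Real.log t + L2 + x j) := Real.exp_le_exp.2 h2
        _ = 2 * t * Real.exp (x j) := by
          rw [Real.exp_add, Real.exp_add, Real.exp_log ht, hL2, Real.exp_log two_pos]; ring
  · -- the covering
    intro g hg
    obtain ⟨a, hprod, hroot, rfl⟩ := hg
    have hapos : ∀ i, 0 < ((a i : ℝ≥0) : ℝ) := fun i =>
      NNReal.coe_pos.2 (pos_iff_ne_zero.2 (a i).ne_zero)
    set y : Fin n → ℝ := fun i => Real.log ((a i : ℝ≥0) : ℝ) with hy
    have hy_sum : ∑ i, y i = 0 := by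
      rw [hy]
      simp only
      rw [← Real.log_prod (s := Finset.univ) (f := fun i => ((a i : ℝ≥0) : ℝ)) (fun i _ => (hapos i).ne'),
        hprod, Real.log_one]
    have hy_root : ∀ i j : Fin n, (j : ℕ) = i + 1 → Real.log t ≤ y i - y j := by
      intro i j hij
      have h := Real.log_le_log (mul_pos ht (hapos j)) (hroot i j hij)
      rw [Real.log_mul ht.ne' (hapos j).ne'] at h
      rw [hy]
      simp only
      linarith
    set k : Fin (n - 1) → ℕ := fun l =>
      ⌊(y ⟨l, by have := l.2; omega⟩ - y ⟨(l : ℕ) + 1, hl l⟩ - Real.log t) / L2⌋₊ with hk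
    set x : Fin n → ℝ := fun i => y i - ∑ l, (k l : ℝ) * ex l i with hx
    refine Set.mem_iUnion.2 ⟨k, Set.mem_mul.2 ⟨_, Set.mem_singleton _, Φ x, ⟨x, ⟨?_, ?_⟩, rfl⟩, ?_⟩⟩
    · -- consecutive differences of `x`
      intro i j hij
      have hi : (i : ℕ) < n - 1 := by have := j.2; omega
      set l₀ : Fin (n - 1) := ⟨i, hi⟩ with hl₀
      have hsum : ∑ l, (k l : ℝ) * (ex l i - ex l j) = k l₀ * L2 := by
        have e : ∀ l : Fin (n - 1), (k l : ℝ) * (ex l i - ex l j) = if l = l₀ then (k l : ℝ) * L2 else 0 := by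
          intro l
          rw [hdiff i j hij l]
          by_cases hll : l = l₀
          · rw [if_pos hll, if_pos (by rw [hll, hl₀])]
          · have : (l : ℕ) ≠ i := fun h => hll (Fin.ext (by rw [hl₀]; exact h))
            rw [if_neg this, if_neg hll, mul_zero]
        simp_rw [e]
        rw [Finset.sum_ite_eq' Finset.univ l₀, if_pos (Finset.mem_univ _)]
      have hxij : x i - x j = (y i - y j) - k l₀ * L2 := by
        rw [hx]
        simp only
        rw [sub_sub_sub_comm, ← Finset.sum_sub_distrib]
        simp_rw [← mul_sub]
        rw [hsum]
      set D : ℝ := y i - y j - Real.log t with hD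
      have hD0 : 0 ≤ D := by have := hy_root i j hij; rw [hD]; linarith
      have hkl₀ : (k l₀ : ℝ) = ⌊D / L2⌋₊ := by
        rw [hk, hD]
        simp only
        have e1 : (⟨((l₀ : Fin (n - 1)) : ℕ), by have := l₀.2; omega⟩ : Fin n) = i := Fin.ext rfl
        have e2 : (⟨((l₀ : Fin (n - 1)) : ℕ) + 1, hl l₀⟩ : Fin n) = j := Fin.ext (by rw [hl₀]; exact hij.symm)
        rw [e1, e2]
      have hfl : (⌊D / L2⌋₊ : ℝ) ≤ D / L2 := Nat.floor_le (div_nonneg hD0 hL2pos.le)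
      have hfl' : D / L2 < ⌊D / L2⌋₊ + 1 := Nat.lt_floor_add_one _
      rw [hxij, hkl₀]
      have e3 : y i - y j = Real.log t + D := by rw [hD]; ring
      rw [e3]
      constructor
      · have : (⌊D / L2⌋₊ : ℝ) * L2 ≤ D := by rwa [← le_div_iff₀ hL2pos]
        linarith
      · have : D < (⌊D / L2⌋₊ + 1) * L2 := by rwa [← div_lt_iff₀ hL2pos]
        linarith
    · -- `∑ xᵢ = 0`
      rw [hx]
      simp only
      rw [Finset.sum_sub_distrib, hy_sum, Finset.sum_comm]
      simp_rw [← Finset.mul_sum, hexsum, mul_zero, Finset.sum_const_zero, sub_zero]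
    · -- `diag(∏ β_l^{k_l}) · Φ(x) = diag(a)`
      rw [hΦ]
      simp only
      rw [← map_mul]
      congr 1
      funext i
      rw [Pi.mul_apply, hbk, ← expUnitNNReal_add, hx]
      simp only
      rw [add_sub_cancel, hy]
      exact expUnitNNReal_log (a i)

end Cone

end Literature.NumberTheory.Automorphic

end
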